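import Summits.CriticalPhenomena.SAWScalingLimit.Theorems.SAWCompassLatticeCompassSLEExact

/-!
# Each open stub of the `CompassSLE` skeleton is downstream of EXISTING items of route SAWTrackTransport
# (crux stmt-CriticalPhenomena-6965, line `registered`, lead c2)

Compositions of the landed certificates (`…YbTightNecessity`, `…YbRestrictionLawNecessity`,
`…YbSimpleOfTrackTransport`, `…CompassSLEExact`), recording for the planners which EXISTING items of the
sibling route SAWTrackTransport each open stub of `Cruxes/CompassSLE/Lines/birth.lean` (v5) waits on:

* `ybTight_of_ybLimitExists`, `ybTraversalBound_of_ybLimitExists` — **T, T1 ⇐ `YBLimitExists`**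
  (stmt-CriticalPhenomena-16995) alone: a full weak limit along `𝓝[>] 0` (`ybFullLimit_of_ybLimitExists`)
  is tight along the mesh by Le Cam along the mesh (`isTightAlongMesh_yb_of_tendsto`), hence set-tight on
  an initial mesh interval, hence the Aizenman–Burchard shape with shell-dependent threshold.
* `ybRestrictionLaw_of_trackTransport` — **I1 ⇐ the five cruxes** `AngleUniversality` (16963),
  `YBLimitExists` (16995), `AxiomsOfLimit` (16965), `RStarRot` (7298), `MirrorRotation` (16997)
  (`ybSquareSLE_of_trackTransport` + `ybRestrictionLaw_of_ybSquareSLE`).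
* (already landed: `ybSubseqLimitSimple_of_trackTransport` — I2b ⇐ `YBLimitExists` ∧ `AxiomsOfLimit`.)
-/

noncomputable section

namespace Summit.CriticalPhenomena.SAWScalingLimit.Theorems.SAWCompassLatticeCompassSLE

open MeasureTheory Filter Topology Set
open scoped NNReal ENNReal
open Literature.Probability.RandomPlanarGeometry
open Literature.Probability.RandomPlanarGeometry.SAW.YangBaxter
open UpperHalfPlane (upperHalfPlaneSet)
open Summit.CriticalPhenomena.SAWScalingLimit.Theses

/-- **T ⇐ `YBLimitExists`**: if the critical square-tiling Yang–Baxter walk has a robust full chordal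
scaling limit (item stmt-CriticalPhenomena-16995), its `π/2` curve laws are tight along the mesh for every
Dobrushin domain and port endpoint approximation (full weak limit `ybFullLimit_of_ybLimitExists` + Le Cam
along the mesh `isTightAlongMesh_yb_of_tendsto`). -/
theorem ybTight_of_ybLimitExists :
    SAWTrackTransport.YBLimitExists →
    ∀ (D : DobrushinDomain) (a b : ℝ → MidEdge),
      IsYBEndpointApprox (fun (_ : ℤ) => Real.pi / 2) D a b →
      IsTightAlongMesh
        (fun δ (γ : YangBaxterSAW (fun (_ : ℤ) => Real.pi / 2) D.carrier δ (a δ) (b δ)) =>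
          γ.curve (fun (_ : ℤ) => Real.pi / 2) δ)
        (fun δ => ybLaw (fun (_ : ℤ) => Real.pi / 2) D.carrier δ 1 (a δ) (b δ)) := by
  intro hL D a b hab
  obtain ⟨μ, hμ, hlim⟩ := ybFullLimit_of_ybLimitExists hL D a b hab
  haveI := hμ
  exact isTightAlongMesh_yb_of_tendsto hab hlim

/-- **T1 ⇐ `YBLimitExists`**: the open stub `stub_ybTraversalBound` of the `CompassSLE` skeleton
(Aizenman–Burchard traversal bound with shell-dependent threshold for GM's `π/2` walk), verbatim after the
item hypothesis, follows from item stmt-CriticalPhenomena-16995 alone (tightness along the mesh ⇒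
set-tightness on an initial mesh interval ⇒ the T1 shape, `K = 1`, `λ = 3`). -/
theorem ybTraversalBound_of_ybLimitExists :
    SAWTrackTransport.YBLimitExists →
    ∀ (D : DobrushinDomain) (a b : ℝ → MidEdge),
      IsYBEndpointApprox (fun (_ : ℤ) => Real.pi / 2) D a b →
      ∃ (k : ℂ → ℝ → ℝ → ℕ) (K lam δ₀ : ℝ), 0 ≤ K ∧ 2 < lam ∧ 0 < δ₀ ∧
        ∀ δ ∈ Set.Ioc (0 : ℝ) δ₀, ∀ (x : ℂ) (ρ R : ℝ), δ ≤ ρ → ρ < R → R ≤ 1 →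
          ybLaw (fun (_ : ℤ) => Real.pi / 2) D.carrier δ 1 (a δ) (b δ)
              {γ | (⟨γ.path (fun (_ : ℤ) => Real.pi / 2) δ⟩ : Curve ℂ).HasTraversals (k x ρ R) x ρ R} ≤
            ENNReal.ofReal (K * (ρ / R) ^ lam) :=
  fun hL D a b hab => ybTraversalBound_of_isTightMeasureSet_image
    (exists_isTightMeasureSet_image_yb hab (ybTight_of_ybLimitExists hL D a b hab))

/-- **I1 ⇐ the five cruxes of route SAWTrackTransport**: the open stub `stub_ybRestrictionLaw` of the
`CompassSLE` skeleton (the Lawler–Schramm–Werner `5/8` restriction law for GM's `π/2` walk), verbatim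
after the item hypotheses `AngleUniversality` (16963), `YBLimitExists` (16995), `AxiomsOfLimit` (16965),
`RStarRot` (7298), `MirrorRotation` (16997) (`ybSquareSLE_of_trackTransport`, then the necessity
certificate `ybRestrictionLaw_of_ybSquareSLE`). [cite: LawlerSchrammWerner2003Restriction, Thm. 6.1 (p. 23)] -/
theorem ybRestrictionLaw_of_trackTransport :
    SAWTrackTransport.AngleUniversality → SAWTrackTransport.YBLimitExists →
    SAWTrackTransport.AxiomsOfLimit → SAWTrackTransport.RStarRot → SAWTrackTransport.MirrorRotation →
    ∀ (D D' : DobrushinDomain) (a b : ℝ → MidEdge),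
      IsYBEndpointApprox (fun (_ : ℤ) => Real.pi / 2) D a b →
      D'.carrier ⊆ D.carrier → D'.pt 0 = D.pt 0 → D'.pt 1 = D.pt 1 →
      (∃ ε : ℝ, 0 < ε ∧ D'.carrier ∩ Metric.ball (D.pt 0) ε = D.carrier ∩ Metric.ball (D.pt 0) ε ∧
        D'.carrier ∩ Metric.ball (D.pt 1) ε = D.carrier ∩ Metric.ball (D.pt 1) ε) →
      ∀ (φ : ConformalEquiv upperHalfPlaneSet D.carrier), D.IsChordalUniformizing φ →
      ∀ (Φ : ConformalEquiv (upperHalfPlaneSet \ φ.pullbackHull D') upperHalfPlaneSet) (d : ℝ),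
        IsRestrictionMap (φ.pullbackHull D') Φ → HasRestrictionDeriv (φ.pullbackHull D') Φ d →
        Tendsto (fun δ => ((ybLaw (fun (_ : ℤ) => Real.pi / 2) D.carrier δ 1 (a δ) (b δ)).map
            (fun γ => γ.curve (fun (_ : ℤ) => Real.pi / 2) δ))
            (CurveClass.rangeSubset (closure D'.carrier)))
          (𝓝[>] (0 : ℝ)) (𝓝 (ENNReal.ofReal (d ^ ((5 : ℝ) / 8)))) :=
  fun h₂ h₃ h₄ h₅ h₇ => ybRestrictionLaw_of_ybSquareSLE (ybSquareSLE_of_trackTransport h₂ h₃ h₄ h₅ h₇)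

end Summit.CriticalPhenomena.SAWScalingLimit.Theorems.SAWCompassLatticeCompassSLE

end
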